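import Summits.NavierStokesRegularity.FluidComputer.PalasekTowerGermHost
import Literature.Analysis.FluidPDE.ClassicalBoundedUniformDerivativeBounds

/-!
# The germ host, superposition door — tools: Landau's inequality on a ball, decay of compactly supported
# data, elementary inequalities for the margins

Cell `ns-blowup`, seat `ns-blowup-ecbridge-3` (g7; D-0074 GROUP C «BRIDGE SUPPORT», lineage
`host_preparation`; bears_on LADDER-NS N1, route `PalasekTowerBreakdown`, crux `EpisodeBase` = item
stmt-NavierStokesRegularity-19179). LABEL: E–C typing (theorems only; no definition, no named fact, no
`sorry`). WHAT THIS IS NOT: not Navier–Stokes evidence — calculus lemmas. Consumer: the superposition door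
`LevelZeroData.exists_superposed_freeRun` (`PalasekTowerGermHostSuperposedFreeRun.lean`).

* `norm_fderiv_le_of_norm_le_on_ball` — Landau's inequality, LOCAL form: `‖D²f‖ ≤ K` everywhere and
  `‖f‖ ≤ δ₀` on `B̄(x, h)` give `‖Df(x)‖ ≤ 2δ₀/h + K h` (the tree's global form is
  `Literature.Analysis.FluidPDE.norm_fderiv_le_of_norm_le_of_norm_iteratedFDeriv_two_le`);
* `decay_of_tsupport_subset` — a field supported in `B̄(0, ρ)` vanishes off the ball;
* `sup_aux_cθ`, `sup_aux_div_le`, `sup_aux_Kh`, `sup_aux_θL`, `sup_aux_err` — the arithmetic of the margins.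

References: G. H. Hardy, J. E. Littlewood, G. Pólya, *Inequalities* §8 [cite: HardyLittlewoodPolya1952, §8 (Landau's inequality)].
-/

noncomputable section

namespace Summit.NavierStokesRegularity.FluidComputer.PalasekTowerClayBridge.Germ

open Set Function Filter Topology Metric
open scoped Topology ContDiff
/-! ## §0 Tools: local Landau inequality, decay of compactly supported data, elementary inequalities -/

/-- `c · (θ/(c+1)) ≤ θ` for `c, θ ≥ 0`. [folklore] -/
theorem sup_aux_cθ {c θ : ℝ} (hc : 0 ≤ c) (hθ : 0 ≤ θ) : c * (θ / (c + 1)) ≤ θ := by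
  rw [mul_div_assoc', div_le_iff₀ (by positivity)]
  nlinarith

/-- `θ/(c+1) ≤ θ` for `c, θ ≥ 0`. [folklore] -/
theorem sup_aux_div_le {c θ : ℝ} (hc : 0 ≤ c) (hθ : 0 ≤ θ) : θ / (c + 1) ≤ θ :=
  div_le_self hθ (by linarith)

/-- `(K + K) · (η/(8K+1)) ≤ η/4` for `K ≥ 0`, `η > 0`. [folklore] -/
theorem sup_aux_Kh {η K : ℝ} (hη : 0 < η) (hK : 0 ≤ K) : (K + K) * (η / (8 * K + 1)) ≤ η / 4 := by
  rw [mul_div_assoc', div_le_iff₀ (by positivity)]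
  nlinarith

/-- `2θL ≤ η/2` when `0 ≤ θ ≤ η/(4(L+1))`, `L ≥ 0`. [folklore] -/
theorem sup_aux_θL {θ η L : ℝ} (hL : 0 ≤ L) (hθ0 : 0 ≤ θ) (h : θ ≤ η / (4 * (L + 1))) :
    2 * θ * L ≤ η / 2 := by
  rw [le_div_iff₀ (by positivity)] at h
  nlinarith

/-- The Landau error budget: `2(θ + ηt)/h + K₂ h ≤ η/2` when `θ ≤ ηh/16`, `0 ≤ ηt ≤ θ`, `K₂ h ≤ η/4`.
[folklore] -/
theorem sup_aux_err {θ ηt h η K₂ : ℝ} (hh : 0 < h) (hθ : θ ≤ η * h / 16) (hηt : ηt ≤ θ)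
    (hK : K₂ * h ≤ η / 4) : 2 * (θ + ηt) / h + K₂ * h ≤ η / 2 := by
  have h1 : 2 * (θ + ηt) / h ≤ η / 4 := by
    rw [div_le_iff₀ hh]; nlinarith
  linarith

/-- **Landau's inequality, local form.** If `f` is `C²` with `‖D²f‖ ≤ K` everywhere and `‖f(z)‖ ≤ δ₀`
on the closed ball `B̄(x, h)` (`h > 0`), then `‖Df(x)‖ ≤ 2δ₀/h + K h` (Taylor along `s ↦ x + s e`,
`‖e‖ = 1`, which stays in the ball). [cite: HardyLittlewoodPolya1952, §8 (Landau's inequality)] -/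
theorem norm_fderiv_le_of_norm_le_on_ball {F : Type*} [NormedAddCommGroup F] [NormedSpace ℝ F]
    {f : EuclideanSpace ℝ (Fin 3) → F} (hf : ContDiff ℝ 2 f)
    {δ₀ K h : ℝ} {x : EuclideanSpace ℝ (Fin 3)} (hh : 0 < h)
    (h0 : ∀ z ∈ closedBall x h, ‖f z‖ ≤ δ₀) (h2 : ∀ z, ‖iteratedFDeriv ℝ 2 f z‖ ≤ K) :
    ‖fderiv ℝ f x‖ ≤ 2 * δ₀ / h + K * h := by
  have hδ₀ : 0 ≤ δ₀ := (norm_nonneg _).trans (h0 x (mem_closedBall_self hh.le))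
  have hK : 0 ≤ K := (norm_nonneg _).trans (h2 x)
  have hf1 : Differentiable ℝ f := hf.differentiable (by norm_num)
  have hdf : Differentiable ℝ (fderiv ℝ f) := by
    have h' : ContDiff ℝ 1 (fderiv ℝ f) := hf.fderiv_right (by norm_num)
    exact h'.differentiable (by norm_num)
  have h2' : ∀ z, ‖fderiv ℝ (fderiv ℝ f) z‖ ≤ K := by
    intro z
    have := h2 z
    rwa [← norm_iteratedFDeriv_fderiv, norm_iteratedFDeriv_one] at this
  have hLip : ∀ y z, ‖fderiv ℝ f y - fderiv ℝ f z‖ ≤ K * ‖y - z‖ := fun y z =>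
    Convex.norm_image_sub_le_of_norm_fderiv_le (f := fderiv ℝ f) (fun w _ => hdf w)
      (fun w _ => h2' w) convex_univ (mem_univ z) (mem_univ y)
  have hunit : ∀ e : EuclideanSpace ℝ (Fin 3), ‖e‖ = 1 → ‖fderiv ℝ f x e‖ ≤ 2 * δ₀ / h + K * h := by
    intro e he
    set φ : ℝ → F := fun s => f (x + s • e) - s • fderiv ℝ f x e with hφ
    have hφd : ∀ s, HasDerivAt φ (fderiv ℝ f (x + s • e) e - fderiv ℝ f x e) s := by
      intro s
      have hγ : HasDerivAt (fun s : ℝ => x + s • e) e s := by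
        simpa using ((hasDerivAt_id s).smul_const e).const_add x
      have h1 : HasDerivAt (fun s : ℝ => f (x + s • e)) (fderiv ℝ f (x + s • e) e) s :=
        (hf1 (x + s • e)).hasFDerivAt.comp_hasDerivAt s hγ
      have h2 : HasDerivAt (fun s : ℝ => s • fderiv ℝ f x e) (fderiv ℝ f x e) s := by
        simpa using (hasDerivAt_id s).smul_const (fderiv ℝ f x e)
      exact h1.sub h2
    have hbound : ∀ s ∈ Ico (0 : ℝ) h, ‖fderiv ℝ f (x + s • e) e - fderiv ℝ f x e‖ ≤ K * h := by
      intro s hs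
      calc ‖fderiv ℝ f (x + s • e) e - fderiv ℝ f x e‖
          = ‖(fderiv ℝ f (x + s • e) - fderiv ℝ f x) e‖ := by rw [sub_apply]
        _ ≤ ‖fderiv ℝ f (x + s • e) - fderiv ℝ f x‖ * ‖e‖ := ContinuousLinearMap.le_opNorm _ _
        _ ≤ K * ‖x + s • e - x‖ * ‖e‖ :=
            mul_le_mul_of_nonneg_right (hLip _ _) (norm_nonneg _)
        _ = K * s := by
            rw [add_sub_cancel_left, norm_smul, he, mul_one, mul_one, Real.norm_of_nonneg hs.1]
        _ ≤ K * h := mul_le_mul_of_nonneg_left hs.2.le hK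
    have hMVT := norm_image_sub_le_of_norm_deriv_le_segment' (f := φ)
      (fun s _ => (hφd s).hasDerivWithinAt) hbound h ⟨hh.le, le_rfl⟩
    have hφh : φ h - φ 0 = (f (x + h • e) - f x) - h • fderiv ℝ f x e := by
      simp only [hφ, zero_smul, add_zero, sub_zero]
      abel
    rw [hφh, sub_zero] at hMVT
    -- the two points used lie in the ball
    have hxh : x + h • e ∈ closedBall x h := by
      rw [mem_closedBall, dist_eq_norm, add_sub_cancel_left, norm_smul, he, mul_one,
        Real.norm_of_nonneg hh.le]
    have hkey : ‖h • fderiv ℝ f x e‖ ≤ 2 * δ₀ + K * h * h := by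
      calc ‖h • fderiv ℝ f x e‖
          = ‖(f (x + h • e) - f x) - ((f (x + h • e) - f x) - h • fderiv ℝ f x e)‖ := by
            rw [sub_sub_cancel]
        _ ≤ ‖f (x + h • e) - f x‖ + ‖(f (x + h • e) - f x) - h • fderiv ℝ f x e‖ := norm_sub_le _ _
        _ ≤ (‖f (x + h • e)‖ + ‖f x‖) + K * h * h := add_le_add (norm_sub_le _ _) hMVT
        _ ≤ (δ₀ + δ₀) + K * h * h := by
            gcongr
            · exact h0 _ hxh
            · exact h0 x (mem_closedBall_self hh.le)
        _ = 2 * δ₀ + K * h * h := by ring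
    rw [norm_smul, Real.norm_of_nonneg hh.le] at hkey
    rw [div_add' _ _ _ hh.ne', le_div_iff₀ hh]
    calc ‖fderiv ℝ f x e‖ * h = h * ‖fderiv ℝ f x e‖ := mul_comm _ _
      _ ≤ 2 * δ₀ + K * h * h := hkey
  exact ContinuousLinearMap.opNorm_le_of_unit_norm (by positivity) hunit

/-- A field supported in `B̄(0, ρ)` vanishes at infinity (it is zero off the ball). [folklore] -/
theorem decay_of_tsupport_subset {U : EuclideanSpace ℝ (Fin 3) → EuclideanSpace ℝ (Fin 3)} {ρ : ℝ}
    (hU : tsupport U ⊆ closedBall 0 ρ) (η : ℝ) (hη : 0 < η) :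
    ∃ Rr : ℝ, ∀ y, Rr ≤ ‖y‖ → ‖U y‖ ≤ η := by
  refine ⟨ρ + 1, fun y hy => ?_⟩
  have hy' : y ∉ tsupport U := by
    intro h
    have := mem_closedBall_zero_iff.1 (hU h)
    linarith
  rw [image_eq_zero_of_notMem_tsupport hy', norm_zero]
  exact hη.le


end Summit.NavierStokesRegularity.FluidComputer.PalasekTowerClayBridge.Germ

end
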